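import Literature.Algebra.Lie.SimpleBaseChange
import Mathlib.Algebra.Lie.Derivation.Killing
import Mathlib.Algebra.Lie.Quotient
import Mathlib.LinearAlgebra.FiniteDimensional.Lemmas
import Mathlib.Tactic.Module
import HarnessLib

/-!
# A Killing Lie subalgebra normalised by an overalgebra with trivial centraliser is the whole overalgebra;
# subalgebras of codimension one normalise a perfect subalgebra

Topic `Literature/Algebra/Lie`.  Theorems only (no definition, no named fact), Mathlib vocabulary (`LieSubalgebra`,
`LieAlgebra.IsKilling`, `LieDerivation`).  Written for the cell `pub-hodgecm2` (COR-CM), seat `b27` (count-neutral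
Mumford–Tate-rank lane): the Hodge Lie algebra `𝔥 = Lie Hg(H¹B)` of an abelian variety without factors of type IV is
semisimple (Killing) and sits inside the Lefschetz Lie algebra `L = C(End⁰B) ∩ 𝔰𝔭(H¹B, ψ)` with trivial centraliser
(`C_L(𝔥) ⊆ Z(End⁰B) ∩ 𝔰𝔭 = 0`); the statements below then say that `𝔥` cannot have codimension one (or, when simple of
dimension `8`, codimension two) in `L` (used in `CorCM/MumfordTateRankTypeTwoFourfoldLefschetz`: a type-II fourfold over `ℚ` has
`dim MT(H¹B) = 11`, Moonen–Zarhin Thm. (0.1) (4)).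

* **`eq_of_isKilling_of_forall_lie_mem_of_centralizer`** — `𝔥 ≤ M` Lie subalgebras, `𝔥` finite-dimensional with
  non-degenerate Killing form, `[M, 𝔥] ⊆ 𝔥` and `C_M(𝔥) = 0` ⟹ `M = 𝔥`.  PROOF: for `x ∈ M`, `ad x|_𝔥` is a derivation
  of `𝔥`, hence inner (every derivation of a finite-dimensional Killing Lie algebra is inner — Mathlib's
  `LieDerivation.IsKilling.exists_eq_ad`; Humphreys §5.3 Thm.), `= ad y` with `y ∈ 𝔥`; then `x − y` centralises `𝔥`, so
  `x = y ∈ 𝔥`.  (Equivalently: a semisimple ideal is complemented by its centraliser, Humphreys §5.2 / Bourbaki I §6.)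
* **`lie_mem_of_finrank_le_succ_of_perfect`** — `𝔥 ≤ M` Lie subalgebras with `dim M ≤ dim 𝔥 + 1` and `𝔥` PERFECT
  (spanned by its brackets) ⟹ `[M, 𝔥] ⊆ 𝔥`: the quotient `M/𝔥` is a Lie module of dimension `≤ 1` for `𝔥`, on which a
  perfect Lie algebra acts trivially (computed by hand: `[x, h] = u_h + c_h x`, and the `x`-coefficient of
  `[x, [h, h′]]` is `c_h c_{h′} − c_{h′} c_h = 0`).
* **`lie_mem_of_isSimple_of_sq_lt_finrank`** — `𝔥 ≤ M` Lie subalgebras with `𝔥` SIMPLE and `(dim M − dim 𝔥)² < dim 𝔥` ⟹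
  `[M, 𝔥] ⊆ 𝔥`: the representation of `𝔥` on `M/𝔥` (Mathlib's quotient Lie module `LieSubmodule.Quotient`, `LieModule.toEnd`)
  has kernel an ideal of the simple `𝔥`, i.e. `0` (impossible: `dim 𝔥 ≤ dim End(M/𝔥) = (dim M − dim 𝔥)²`) or `𝔥` (trivial
  action).  (Codimension `2` for `dim 𝔥 = 8`: used for «a type-II fourfold over `ℚ` has `dim MT(H¹B) ≠ 9`».)

## References
* [Humphreys1972] J. E. Humphreys, *Introduction to Lie Algebras and Representation Theory*, GTM 9 (1972), §5.2
  (a semisimple `L` is perfect; ideals), §5.3 Theorem («every derivation of a semisimple Lie algebra is inner»).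
-/

namespace Literature.Algebra.Lie

namespace KillingCodimension

open Module Literature.Algebra.Lie.SimpleBaseChange

variable {K : Type*} [Field K] {A : Type*} [LieRing A] [LieAlgebra K A]

/-- **A finite-dimensional Killing Lie subalgebra `𝔥 ≤ M` with `[M, 𝔥] ⊆ 𝔥` and trivial centraliser `C_M(𝔥) = 0` is all
of `M`**: `ad x|_𝔥` (`x ∈ M`) is a derivation of `𝔥`, hence `= ad y` for some `y ∈ 𝔥` (all derivations of a Killing Lie
algebra are inner), and `x − y ∈ C_M(𝔥) = 0`. [cite: Humphreys1972, §5.3 Theorem (derivations of a semisimple Lie algebra are inner)] -/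
theorem eq_of_isKilling_of_forall_lie_mem_of_centralizer (𝔥 M : LieSubalgebra K A) (hle : 𝔥 ≤ M)
    [Module.Finite K 𝔥] [LieAlgebra.IsKilling K 𝔥] (hideal : ∀ x ∈ M, ∀ h ∈ 𝔥, ⁅x, h⁆ ∈ 𝔥)
    (hcent : ∀ x ∈ M, (∀ h ∈ 𝔥, ⁅x, h⁆ = 0) → x = 0) : M = 𝔥 := by
  refine le_antisymm (fun x hx => ?_) hle
  -- `ad x|_𝔥` as a derivation of `𝔥`
  let D : LieDerivation K 𝔥 𝔥 :=
    { toFun := fun h => ⟨⁅x, (h : A)⁆, hideal x hx h h.2⟩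
      map_add' := fun h h' => by
        apply Subtype.ext
        change ⁅x, (h : A) + (h' : A)⁆ = ⁅x, (h : A)⁆ + ⁅x, (h' : A)⁆
        rw [lie_add]
      map_smul' := fun c h => by
        apply Subtype.ext
        change ⁅x, c • (h : A)⁆ = c • ⁅x, (h : A)⁆
        rw [lie_smul]
      leibniz' := fun a b => by
        apply Subtype.ext
        change ⁅x, ⁅(a : A), (b : A)⁆⁆ = ⁅(a : A), ⁅x, (b : A)⁆⁆ - ⁅(b : A), ⁅x, (a : A)⁆⁆
        rw [leibniz_lie, ← lie_skew (b : A) ⁅x, (a : A)⁆]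
        abel }
  have hD : ∀ h : 𝔥, ((D h : 𝔥) : A) = ⁅x, (h : A)⁆ := fun h => rfl
  obtain ⟨y, hy⟩ := LieDerivation.IsKilling.exists_eq_ad D
  -- `x − y` centralises `𝔥`
  have hxy : ∀ h ∈ 𝔥, ⁅x - (y : A), h⁆ = 0 := by
    intro h hh
    have h2 : (⁅y, (⟨h, hh⟩ : 𝔥)⁆ : 𝔥) = D ⟨h, hh⟩ := by
      simpa using congrArg (fun E : LieDerivation K 𝔥 𝔥 => E ⟨h, hh⟩) hy
    have h3 : (⁅(y : A), h⁆ : A) = ⁅x, h⁆ := by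
      simpa [hD] using congrArg Subtype.val h2
    rw [sub_lie, h3, sub_self]
  have h0 := hcent (x - y) (M.sub_mem hx (hle y.2)) hxy
  rw [sub_eq_zero] at h0
  rw [h0]
  exact y.2

/-- **A subalgebra of codimension `≤ 1` normalises a perfect subalgebra**: `𝔥 ≤ M` Lie subalgebras,
`dim M ≤ dim 𝔥 + 1`, `𝔥` spanned by its brackets `[u, v]` (`u, v ∈ 𝔥`) ⟹ `[x, h] ∈ 𝔥` for all `x ∈ M`, `h ∈ 𝔥` — the
`≤ 1`-dimensional `𝔥`-module `M/𝔥` is trivial for a perfect `𝔥`. [cite: Humphreys1972, §5.2 (a semisimple Lie algebra equals its derived algebra)] -/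
theorem lie_mem_of_finrank_le_succ_of_perfect (𝔥 M : LieSubalgebra K A) (hle : 𝔥 ≤ M) [FiniteDimensional K M]
    (hdim : finrank K M ≤ finrank K 𝔥 + 1)
    (hperf : 𝔥.toSubmodule ≤ Submodule.span K {b : A | ∃ u ∈ 𝔥, ∃ v ∈ 𝔥, ⁅u, v⁆ = b}) :
    ∀ x ∈ M, ∀ h ∈ 𝔥, ⁅x, h⁆ ∈ 𝔥 := by
  classical
  intro x hx
  by_cases hxh : x ∈ 𝔥
  · exact fun h hh => 𝔥.lie_mem hxh hh
  -- `M = 𝔥 ⊕ K x`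
  have hle' : 𝔥.toSubmodule ≤ M.toSubmodule := fun z hz => hle hz
  haveI : FiniteDimensional K M.toSubmodule := ‹FiniteDimensional K M›
  haveI : FiniteDimensional K 𝔥.toSubmodule := Submodule.finiteDimensional_of_le hle'
  have hx0 : x ≠ 0 := fun h0 => hxh (by rw [h0]; exact 𝔥.zero_mem)
  have hsup : M.toSubmodule = 𝔥.toSubmodule ⊔ K ∙ x := by
    refine (Submodule.eq_of_le_of_finrank_le (sup_le hle' ((Submodule.span_singleton_le_iff_mem x M.toSubmodule).2 hx))
      ?_).symm
    have hdisj : 𝔥.toSubmodule ⊓ (K ∙ x) = ⊥ := by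
      rw [Submodule.eq_bot_iff]
      intro z hz
      obtain ⟨hz1, hz2⟩ := Submodule.mem_inf.1 hz
      obtain ⟨c, rfl⟩ := Submodule.mem_span_singleton.1 hz2
      by_cases hc : c = 0
      · rw [hc, zero_smul]
      · exfalso
        apply hxh
        have h3 : c⁻¹ • c • x ∈ 𝔥.toSubmodule := 𝔥.toSubmodule.smul_mem c⁻¹ hz1
        rwa [smul_smul, inv_mul_cancel₀ hc, one_smul] at h3
    have h1 := Submodule.finrank_sup_add_finrank_inf_eq 𝔥.toSubmodule (K ∙ x)
    rw [hdisj, finrank_bot, add_zero, finrank_span_singleton hx0] at h1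
    rw [h1]
    exact hdim
  have hdec : ∀ m ∈ M, ∃ u ∈ 𝔥, ∃ c : K, m = u + c • x := by
    intro m hm
    have hm' : m ∈ 𝔥.toSubmodule ⊔ K ∙ x := by rw [← hsup]; exact hm
    obtain ⟨u, hu, w, hw, rfl⟩ := Submodule.mem_sup.1 hm'
    obtain ⟨c, rfl⟩ := Submodule.mem_span_singleton.1 hw
    exact ⟨u, hu, c, rfl⟩
  -- the `x`-coefficient of `[x, [h, h′]]` vanishes
  have hbr : ∀ h ∈ 𝔥, ∀ h' ∈ 𝔥, ⁅x, ⁅h, h'⁆⁆ ∈ 𝔥 := by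
    intro h hh h' hh'
    obtain ⟨u, hu, c, hc⟩ := hdec _ (M.lie_mem hx (hle hh))
    obtain ⟨u', hu', c', hc'⟩ := hdec _ (M.lie_mem hx (hle hh'))
    have e1 : ⁅h, x⁆ = -(u + c • x) := by rw [← lie_skew, hc]
    have key : ⁅x, ⁅h, h'⁆⁆ = ⁅u, h'⁆ + ⁅h, u'⁆ + c • u' - c' • u := by
      rw [leibniz_lie, hc, add_lie, smul_lie, hc', lie_add, lie_smul, e1]
      module
    rw [key]
    exact 𝔥.sub_mem (𝔥.add_mem (𝔥.add_mem (𝔥.lie_mem hu hh') (𝔥.lie_mem hh hu')) (𝔥.smul_mem c hu'))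
      (𝔥.smul_mem c' hu)
  -- perfectness: every `h ∈ 𝔥` is a combination of brackets
  intro h hh
  have hmem : h ∈ Submodule.span K {b : A | ∃ u ∈ 𝔥, ∃ v ∈ 𝔥, ⁅u, v⁆ = b} := hperf hh
  clear hh
  induction hmem using Submodule.span_induction with
  | mem b hb =>
    obtain ⟨u, hu, v, hv, rfl⟩ := hb
    exact hbr u hu v hv
  | zero => rw [lie_zero]; exact 𝔥.zero_mem
  | add b b' _ _ hb hb' => rw [lie_add]; exact 𝔥.add_mem hb hb'
  | smul c b _ hb => rw [lie_smul]; exact 𝔥.smul_mem c hb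

/-- **A SIMPLE subalgebra `𝔥 ≤ M` with `(dim M − dim 𝔥)² < dim 𝔥` is normalised by `M`**: the kernel of the representation of
`𝔥` on the quotient module `M/𝔥` is an ideal of the simple Lie algebra `𝔥`; it is not `0` (an injection
`𝔥 ↪ End(M/𝔥)` would give `dim 𝔥 ≤ (dim M − dim 𝔥)²`), so it is `𝔥`: `[h, x] ∈ 𝔥` for all `h ∈ 𝔥`, `x ∈ M`.
[cite: Humphreys1972, §5.2 (simple Lie algebras: ideals `0`, `L`)] -/
theorem lie_mem_of_isSimple_of_sq_lt_finrank (𝔥 M : LieSubalgebra K A) (hle : 𝔥 ≤ M) [FiniteDimensional K M]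
    [LieAlgebra.IsSimple K 𝔥] (hlt : (finrank K M - finrank K 𝔥) ^ 2 < finrank K 𝔥) :
    ∀ x ∈ M, ∀ h ∈ 𝔥, ⁅x, h⁆ ∈ 𝔥 := by
  classical
  -- the copy `𝔥'` of `𝔥` inside the Lie algebra `M` and the quotient module `M ⧸ 𝔥'`
  haveI : LieAlgebra.IsSimple K (LieSubalgebra.ofLe hle) := isSimple_of_lieEquiv (LieSubalgebra.equivOfLe hle).symm
  obtain ⟨N, hN⟩ : ∃ N : LieSubmodule K (LieSubalgebra.ofLe hle) M, N = (LieSubalgebra.ofLe hle).toLieSubmodule := ⟨_, rfl⟩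
  have hmemN : ∀ m : M, m ∈ N ↔ (m : A) ∈ 𝔥 := fun m => by
    rw [hN, LieSubalgebra.mem_toLieSubmodule, LieSubalgebra.mem_ofLe]
  letI : LieRing (Module.End K (M ⧸ N)) := LieRing.ofAssociativeRing
  obtain ⟨ρ, hρ⟩ : ∃ ρ : (LieSubalgebra.ofLe hle) →ₗ⁅K⁆ Module.End K (M ⧸ N), ρ = LieModule.toEnd K _ (M ⧸ N) := ⟨_, rfl⟩
  -- dimensions: `dim 𝔥' = dim 𝔥`, `dim (M ⧸ N) = dim M − dim 𝔥`
  have hd𝔥 : finrank K (LieSubalgebra.ofLe hle) = finrank K 𝔥 := (LieSubalgebra.equivOfLe hle).toLinearEquiv.finrank_eq.symm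
  have hdN : finrank K (N : Submodule K M) = finrank K 𝔥 := by rw [← hd𝔥, hN]; rfl
  have hq : finrank K (M ⧸ N) + finrank K 𝔥 = finrank K M := by
    rw [← hdN]
    exact Submodule.finrank_quotient_add_finrank (N : Submodule K M)
  rcases LieAlgebra.IsSimple.eq_bot_or_eq_top (LieHom.ker ρ) with hbot | htop
  · -- `ρ` injective: `dim 𝔥 ≤ dim End(M ⧸ N) = (dim M − dim 𝔥)²`, a contradiction
    exfalso
    have hinj : Function.Injective ρ := (LieHom.ker_eq_bot ρ).1 hbot
    have h1 := LinearMap.finrank_le_finrank_of_injective (f := (ρ : (LieSubalgebra.ofLe hle) →ₗ[K] Module.End K (M ⧸ N)))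
      hinj
    rw [Module.finrank_linearMap, hd𝔥, show finrank K (↥M ⧸ N) = finrank K M - finrank K 𝔥 by omega, ← sq] at h1
    exact absurd (lt_of_le_of_lt h1 hlt) (lt_irrefl _)
  · -- `ρ = 0`: `⁅h, x⁆ ∈ 𝔥`
    intro x hx h hh
    have hh' : (⟨h, hle hh⟩ : M) ∈ LieSubalgebra.ofLe hle := by rw [LieSubalgebra.mem_ofLe]; exact hh
    have hker : (⟨⟨h, hle hh⟩, hh'⟩ : LieSubalgebra.ofLe hle) ∈ LieHom.ker ρ := by rw [htop]; exact LieSubmodule.mem_top _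
    rw [LieHom.mem_ker, hρ] at hker
    have h0 := LinearMap.congr_fun hker (LieSubmodule.Quotient.mk' N ⟨x, hx⟩)
    rw [LieModule.toEnd_apply_apply, LinearMap.zero_apply, ← LieModuleHom.map_lie, LieSubmodule.Quotient.mk_eq_zero, hmemN,
      LieSubalgebra.coe_bracket_of_module] at h0
    -- `h0 : ((⁅(⟨h, _⟩ : M), (⟨x, hx⟩ : M)⁆ : M) : A) ∈ 𝔥`, i.e. `⁅h, x⁆ ∈ 𝔥`
    rw [LieSubalgebra.coe_bracket] at h0
    change ⁅h, x⁆ ∈ 𝔥 at h0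
    rw [← lie_skew, neg_mem_iff]
    exact h0

end KillingCodimension

end Literature.Algebra.Lie
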